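import Mathlib
import HarnessLib
import Summits.HubbardSuperconductivity.HubbardSuperconductivity.Theorems.KLProgrammeC4aAntidiagonalFlatness

/-!
# Route `KLProgramme` — crux C4a, S3 brick (B4) «(B4)-UMK1», «(M1)-TRUE-KERNEL»: the anti-diagonal flatness number in WEIGHTED-L¹ FORM —
# the IBP of `…C4aAntidiagonalFlatness` with the support hypotheses replaced by integral/small-sup data and the boundary term discharged
# by the finer-line split `κ(1) = 0` (OR the numerator's `n(D) = 0`)

Cell `gate-hubbard-kl`, seat hubbard-kl-k3c3-p1 (g15; row «δμ-flow with klAngularMean constant piece»).  Located brick for the (C)-closer lane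
hubbard-kl-c4a-1 / the (U1) chain of hubbard-kl-k3c3-p3 (stub (C) `stub_twoLeg_curvature` of `KLRegimeEngineV17F2`, stmt-HubbardSuperconductivity-20437;
memo HOME/hubbard-kl-k3c3-p3/U1-CAUSTIC-SUP.md §9 «NOT typed: the (B3) kernel in ratio form for (M1)»).

WHY A TWIN.  `abs_integral_antidiagonal_flatness_le` (p671506) proves `|∫_0^D ∂_uK(e, D−e) de| ≤ 8cκ₀·lo/D²` for `K = N(e,u)κ(e/(e+u))/(e+u)` under
LEVEL-CUTOFF hypotheses on the numerator: `N(D,0) = 0`, `∂_eN = 0` for `e ≥ 2lo`, `∂_uN = 0` for `e ≤ D − 2lo`.  For the model's ACTUAL pp kernel — Matsubara sum of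
two above-scale lines with the Salmhofer frequency–momentum cutoff `W = χ((ω²+e²)/Λ²)` (`uvWeightFn`) — partial fractions
`1/((−iω+e)(−i(Ω−ω)+u)) = [1/(−iω+e) + 1/(−i(Ω−ω)+u)]/(e+u−iΩ)` DO give the ratio form `N/(e+u−iΩ)`, but the numerator is NOT a level cutoff:
`N(D,0⁺) ≈ 0.48 ≠ 0` (the zero-level line still propagates through `|ω| ≥ Λ/2`) and `∂_uN` has an `e ≤ Λ` tail of size `≲ Λ/u²` (seat numerics [float]:
with the finer-line split the flatness number is `≈ 0.26·Λ/D²`, without it `≈ −0.48/D` — the split's `κ(1) = 0` is load-bearing).  This file re-proves the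
IBP in the form the true kernel meets:
* §1 **`intervalIntegral_antidiagonal_eq_cutoff_pieces`** — the EXACT identity: with `n′ = n₁ − n₂` on `[0,D]`, `κ ∈ C¹`, and the boundary condition
  `n(D)·κ(1) = 0` (either factor), for `Ku(e) = n₂κ(e/D)/D − n(κ′(e/D)(e/D) + κ(e/D))/D²`:
  `∫_0^D Ku = (1/D)·(∫_0^D n₁·(e/D)κ(e/D) + ∫_0^D n₂·((D−e)/D)κ(e/D))` — the degree-(−1) homogeneous bulk cancels, only numerator derivatives survive;
* §2 **`abs_integral_antidiagonal_flatness_le_of_L1`** — the weighted-L¹ bound `|∫_0^D Ku| ≤ (M₁ + M₂)/D²` from `∫_0^D |n₁ e·κ(e/D)|·e ≤ M₁`,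
  `∫_0^D |n₂ e·κ(e/D)|·(D − e) ≤ M₂`;
* §3 **`abs_integral_antidiagonal_flatness_le_of_split`** — the corollary in (N2)'s currency for the true kernel's shape: `|n₁| ≤ c/lo` with `n₁ = 0` for
  `e ≥ 2lo` (the `e`-line's cutoff derivative), `|n₂ e·κ(e/D)| ≤ ε₂` on `[0,D]` (the far line's small `u`-derivative on the split's support), `|κ| ≤ κ₀`,
  boundary `n(D)·κ(1) = 0`:  `|∫_0^D Ku| ≤ 4cκ₀·lo/D² + ε₂/2`  (with `ε₂ ≲ κ₀Λ/(t₁D)²` on a split supported in `e/(e+u) ≤ t₁ < 1` this is `lo/D²`-class);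
* §4 `abs_integral_antidiagonal_flatness_le'` — p671506's statement with `n(D) = 0` weakened to `n(D)·κ(1) = 0` (same bound `8cκ₀·lo/D²`).
Pure real analysis (one integration by parts + triangle inequalities); nothing about the model; nothing asserts (C), K3 or superconductivity.
References: FST II CPAM 51 (1998) §3 [cite: FeldmanSalmhoferTrubowitz1998]; Salmhofer 1999 §4.5.3 [cite: Salmhofer1999].
-/

noncomputable section

namespace Summit.HubbardSuperconductivity.HubbardSuperconductivity.Theorems.C4a

set_option linter.dupNamespace false -- summit = problem name (single-conjunct summit), D-0017

open Real Set MeasureTheory intervalIntegral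
open scoped Interval

/-! ## §1 The exact identity -/

/-- **THE ANTI-DIAGONAL IBP IDENTITY.**  `0 < D`; along `e ∈ [0,D]`: `n′ = n₁ − n₂` (`n₁, n₂` continuous), `κ ∈ C¹`, boundary `n(D)·κ(1) = 0`, and
`Ku(e) = n₂κ(e/D)/D − n(κ′(e/D)(e/D) + κ(e/D))/D²` (`= ∂_u[Nκ(e/(e+u))/(e+u)](e, D−e)`, `…AntidiagonalFlatness` §1).  THEN
`∫_0^D Ku = (1/D)·(∫_0^D n₁(e)·((e/D)κ(e/D)) de + ∫_0^D n₂(e)·(((D−e)/D)κ(e/D)) de)`. [folklore] -/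
theorem intervalIntegral_antidiagonal_eq_cutoff_pieces {n n₁ n₂ κ κ' Ku : ℝ → ℝ} {D : ℝ} (hD : 0 < D)
    (hn : ∀ e ∈ Icc 0 D, HasDerivAt n (n₁ e - n₂ e) e) (hn₁c : Continuous n₁) (hn₂c : Continuous n₂)
    (hκ : ∀ t, HasDerivAt κ (κ' t) t) (hκ'c : Continuous κ')
    (hbd : n D * κ 1 = 0)
    (hKu : ∀ e ∈ Icc 0 D, Ku e = n₂ e * κ (e / D) / D - n e * (κ' (e / D) * (e / D) + κ (e / D)) / D ^ 2) :
    ∫ e in (0 : ℝ)..D, Ku e =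
      1 / D * ((∫ e in (0 : ℝ)..D, n₁ e * (e / D * κ (e / D))) + ∫ e in (0 : ℝ)..D, n₂ e * ((D - e) / D * κ (e / D))) := by
  have hκc : Continuous κ := continuous_iff_continuousAt.2 fun t => (hκ t).continuousAt
  have hD0 : D ≠ 0 := hD.ne'
  -- the bulk primitive `m(e) = (e/D)·κ(e/D)` and its derivative
  set m : ℝ → ℝ := fun e => e / D * κ (e / D) with hm
  set m' : ℝ → ℝ := fun e => (κ' (e / D) * (e / D) + κ (e / D)) / D with hm'
  have hmd : ∀ e, HasDerivAt m (m' e) e := fun e => by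
    have h1 : HasDerivAt (fun e : ℝ => e / D) (1 / D) e := by simpa using (hasDerivAt_id e).div_const D
    have h2 : HasDerivAt (fun e : ℝ => κ (e / D)) (κ' (e / D) * (1 / D)) e := (hκ (e / D)).comp e h1
    have h := h1.mul h2
    refine h.congr_deriv ?_
    simp only [hm']
    field_simp
    ring
  have hm'c : Continuous m' := by
    simp only [hm']
    exact (((hκ'c.comp (continuous_id.div_const D)).mul (continuous_id.div_const D)).add (hκc.comp (continuous_id.div_const D))).div_const D
  have hnc : ContinuousOn n (Icc 0 D) := fun e he => (hn e he).continuousAt.continuousWithinAt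
  have hmD : m D = κ 1 := by simp only [hm]; rw [div_self hD0, one_mul]
  have hm0 : m 0 = 0 := by simp only [hm]; rw [zero_div, zero_mul]
  -- integration by parts: `∫ n·m′ = n D m D − n 0 m 0 − ∫ (n₁ − n₂)·m = −∫ (n₁ − n₂)·m`
  have hIBP : ∫ e in (0 : ℝ)..D, n e * m' e = -∫ e in (0 : ℝ)..D, (n₁ e - n₂ e) * m e := by
    have h := intervalIntegral.integral_mul_deriv_eq_deriv_mul (a := (0 : ℝ)) (b := D) (u := n) (v := m) (u' := fun e => n₁ e - n₂ e) (v' := m')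
      (fun e he => hn e (by rwa [uIcc_of_le hD.le] at he)) (fun e _ => hmd e)
      ((hn₁c.sub hn₂c).intervalIntegrable _ _) (hm'c.intervalIntegrable _ _)
    rw [h, hmD, hm0, hbd, mul_zero, sub_zero, zero_sub]
  -- rewrite the integrand
  have hKu' : ∀ e ∈ uIcc (0 : ℝ) D, Ku e = (1 / D) * (n₂ e * κ (e / D)) - (1 / D) * (n e * m' e) := fun e he => by
    rw [uIcc_of_le hD.le] at he
    rw [hKu e he]
    simp only [hm']
    field_simp
  have hi₂ : IntervalIntegrable (fun e => n₂ e * κ (e / D)) volume 0 D := (hn₂c.mul (hκc.comp (continuous_id.div_const D))).intervalIntegrable _ _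
  have hi₃ : IntervalIntegrable (fun e => n e * m' e) volume 0 D := by
    refine (hnc.mul hm'c.continuousOn).intervalIntegrable_of_Icc hD.le
  rw [intervalIntegral.integral_congr hKu', intervalIntegral.integral_sub (hi₂.const_mul _) (hi₃.const_mul _),
    intervalIntegral.integral_const_mul, intervalIntegral.integral_const_mul, hIBP]
  -- combine into the two cutoff pieces
  have hi₄ : IntervalIntegrable (fun e => n₁ e * m e) volume 0 D :=
    (hn₁c.mul ((continuous_id.div_const D).mul (hκc.comp (continuous_id.div_const D)))).intervalIntegrable _ _
  have hi₅ : IntervalIntegrable (fun e => n₂ e * ((D - e) / D * κ (e / D))) volume 0 D :=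
    (hn₂c.mul (((continuous_const.sub continuous_id).div_const D).mul (hκc.comp (continuous_id.div_const D)))).intervalIntegrable _ _
  have hsplit : (∫ e in (0 : ℝ)..D, n₂ e * κ (e / D)) + ∫ e in (0 : ℝ)..D, (n₁ e - n₂ e) * m e =
      (∫ e in (0 : ℝ)..D, n₁ e * m e) + ∫ e in (0 : ℝ)..D, n₂ e * ((D - e) / D * κ (e / D)) := by
    have hi₆ : IntervalIntegrable (fun e => (n₁ e - n₂ e) * m e) volume 0 D :=
      ((hn₁c.sub hn₂c).mul ((continuous_id.div_const D).mul (hκc.comp (continuous_id.div_const D)))).intervalIntegrable _ _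
    rw [← intervalIntegral.integral_add hi₂ hi₆, ← intervalIntegral.integral_add hi₄ hi₅]
    refine intervalIntegral.integral_congr fun e _ => ?_
    simp only [hm]
    field_simp
    ring
  rw [← hsplit]
  ring

/-! ## §2 The weighted-L¹ form -/

/-- **THE FLATNESS NUMBER IN WEIGHTED-L¹ FORM.**  Under the hypotheses of `intervalIntegral_antidiagonal_eq_cutoff_pieces`, if
`∫_0^D |n₁ e·κ(e/D)|·e de ≤ M₁` and `∫_0^D |n₂ e·κ(e/D)|·(D − e) de ≤ M₂` then `|∫_0^D Ku| ≤ (M₁ + M₂)/D²`. [folklore] -/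
theorem abs_integral_antidiagonal_flatness_le_of_L1 {n n₁ n₂ κ κ' Ku : ℝ → ℝ} {D M₁ M₂ : ℝ} (hD : 0 < D)
    (hn : ∀ e ∈ Icc 0 D, HasDerivAt n (n₁ e - n₂ e) e) (hn₁c : Continuous n₁) (hn₂c : Continuous n₂)
    (hκ : ∀ t, HasDerivAt κ (κ' t) t) (hκ'c : Continuous κ')
    (hbd : n D * κ 1 = 0)
    (hKu : ∀ e ∈ Icc 0 D, Ku e = n₂ e * κ (e / D) / D - n e * (κ' (e / D) * (e / D) + κ (e / D)) / D ^ 2)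
    (hM₁ : ∫ e in (0 : ℝ)..D, |n₁ e * κ (e / D)| * e ≤ M₁) (hM₂ : ∫ e in (0 : ℝ)..D, |n₂ e * κ (e / D)| * (D - e) ≤ M₂) :
    |∫ e in (0 : ℝ)..D, Ku e| ≤ (M₁ + M₂) / D ^ 2 := by
  have hκc : Continuous κ := continuous_iff_continuousAt.2 fun t => (hκ t).continuousAt
  have hD0 : D ≠ 0 := hD.ne'
  rw [intervalIntegral_antidiagonal_eq_cutoff_pieces hD hn hn₁c hn₂c hκ hκ'c hbd hKu, abs_mul,
    abs_of_pos (by positivity : (0 : ℝ) < 1 / D)]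
  -- the two pieces
  have hκD : Continuous fun e : ℝ => κ (e / D) := hκc.comp (continuous_id.div_const D)
  have hp1 : |∫ e in (0 : ℝ)..D, n₁ e * (e / D * κ (e / D))| ≤ M₁ / D := by
    have hle : ∫ e in (0 : ℝ)..D, |n₁ e * (e / D * κ (e / D))| = (1 / D) * ∫ e in (0 : ℝ)..D, |n₁ e * κ (e / D)| * e := by
      rw [← intervalIntegral.integral_const_mul]
      refine intervalIntegral.integral_congr fun e he => ?_
      rw [uIcc_of_le hD.le] at he
      rw [show n₁ e * (e / D * κ (e / D)) = (n₁ e * κ (e / D)) * (e / D) by ring, abs_mul, abs_of_nonneg (div_nonneg he.1 hD.le)]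
      field_simp
    calc |∫ e in (0 : ℝ)..D, n₁ e * (e / D * κ (e / D))| ≤ ∫ e in (0 : ℝ)..D, |n₁ e * (e / D * κ (e / D))| :=
          intervalIntegral.abs_integral_le_integral_abs hD.le
      _ = (1 / D) * ∫ e in (0 : ℝ)..D, |n₁ e * κ (e / D)| * e := hle
      _ ≤ (1 / D) * M₁ := mul_le_mul_of_nonneg_left hM₁ (by positivity)
      _ = M₁ / D := by field_simp
  have hp2 : |∫ e in (0 : ℝ)..D, n₂ e * ((D - e) / D * κ (e / D))| ≤ M₂ / D := by
    have hle : ∫ e in (0 : ℝ)..D, |n₂ e * ((D - e) / D * κ (e / D))| = (1 / D) * ∫ e in (0 : ℝ)..D, |n₂ e * κ (e / D)| * (D - e) := by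
      rw [← intervalIntegral.integral_const_mul]
      refine intervalIntegral.integral_congr fun e he => ?_
      rw [uIcc_of_le hD.le] at he
      rw [show n₂ e * ((D - e) / D * κ (e / D)) = (n₂ e * κ (e / D)) * ((D - e) / D) by ring, abs_mul,
        abs_of_nonneg (div_nonneg (by linarith [he.2]) hD.le)]
      field_simp
    calc |∫ e in (0 : ℝ)..D, n₂ e * ((D - e) / D * κ (e / D))| ≤ ∫ e in (0 : ℝ)..D, |n₂ e * ((D - e) / D * κ (e / D))| :=
          intervalIntegral.abs_integral_le_integral_abs hD.le
      _ = (1 / D) * ∫ e in (0 : ℝ)..D, |n₂ e * κ (e / D)| * (D - e) := hle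
      _ ≤ (1 / D) * M₂ := mul_le_mul_of_nonneg_left hM₂ (by positivity)
      _ = M₂ / D := by field_simp
  have htri := abs_add_le (∫ e in (0 : ℝ)..D, n₁ e * (e / D * κ (e / D))) (∫ e in (0 : ℝ)..D, n₂ e * ((D - e) / D * κ (e / D)))
  calc 1 / D * |(∫ e in (0 : ℝ)..D, n₁ e * (e / D * κ (e / D))) + ∫ e in (0 : ℝ)..D, n₂ e * ((D - e) / D * κ (e / D))|
      ≤ 1 / D * (M₁ / D + M₂ / D) := mul_le_mul_of_nonneg_left (htri.trans (add_le_add hp1 hp2)) (by positivity)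
    _ = (M₁ + M₂) / D ^ 2 := by field_simp

/-! ## §3 The corollary in (N2)'s currency: `e`-line cutoff support + a small far-line `u`-derivative on the split's support -/

/-- **THE FLATNESS NUMBER FOR A TRUE-KERNEL-SHAPED NUMERATOR.**  `0 < D`, `0 < lo`, `0 ≤ c, κ₀`.  Along `e ∈ [0,D]`: `n′ = n₁ − n₂` (continuous
densities), `|n₁| ≤ c/lo` with `n₁ = 0` for `e ≥ 2lo` (the `e`-line's cutoff derivative), `|n₂(e)·κ(e/D)| ≤ ε₂` (the far line's `u`-derivative is small
WHERE THE SPLIT PROFILE LIVES — no support condition), `κ ∈ C¹` with `|κ| ≤ κ₀` on `[0,1]`, boundary `n(D)·κ(1) = 0` (finer-line split `κ(1) = 0`, or a level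
cutoff `n(D) = 0`), `Ku` as in §1.  THEN  `|∫_0^D Ku| ≤ 4cκ₀·lo/D² + ε₂/2`. [folklore] -/
theorem abs_integral_antidiagonal_flatness_le_of_split {n n₁ n₂ κ κ' Ku : ℝ → ℝ} {D lo c κ₀ ε₂ : ℝ} (hD : 0 < D) (hlo : 0 < lo)
    (hc : 0 ≤ c) (hκ₀ : 0 ≤ κ₀)
    (hn : ∀ e ∈ Icc 0 D, HasDerivAt n (n₁ e - n₂ e) e) (hn₁c : Continuous n₁) (hn₂c : Continuous n₂)
    (hκ : ∀ t, HasDerivAt κ (κ' t) t) (hκ'c : Continuous κ')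
    (hbd : n D * κ 1 = 0)
    (hn₁b : ∀ e ∈ Icc 0 D, |n₁ e| ≤ c / lo) (hn₁s : ∀ e ∈ Icc 0 D, 2 * lo ≤ e → n₁ e = 0)
    (hn₂κ : ∀ e ∈ Icc 0 D, |n₂ e * κ (e / D)| ≤ ε₂)
    (hκb : ∀ t ∈ Icc 0 1, |κ t| ≤ κ₀)
    (hKu : ∀ e ∈ Icc 0 D, Ku e = n₂ e * κ (e / D) / D - n e * (κ' (e / D) * (e / D) + κ (e / D)) / D ^ 2) :
    |∫ e in (0 : ℝ)..D, Ku e| ≤ 4 * c * κ₀ * lo / D ^ 2 + ε₂ / 2 := by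
  have hκc : Continuous κ := continuous_iff_continuousAt.2 fun t => (hκ t).continuousAt
  have hD0 : D ≠ 0 := hD.ne'
  rw [intervalIntegral_antidiagonal_eq_cutoff_pieces hD hn hn₁c hn₂c hκ hκ'c hbd hKu, abs_mul,
    abs_of_pos (by positivity : (0 : ℝ) < 1 / D)]
  have hκe : ∀ e ∈ Icc (0 : ℝ) D, |κ (e / D)| ≤ κ₀ := fun e he =>
    hκb (e / D) ⟨div_nonneg he.1 hD.le, (div_le_one hD).2 he.2⟩
  -- the `e`-line piece: small support at the left end
  have hp1 : |∫ e in (0 : ℝ)..D, n₁ e * (e / D * κ (e / D))| ≤ 4 * c * κ₀ * lo / D := by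
    refine abs_intervalIntegral_le_of_small_support_left hD hlo hc hκ₀ (fun e he => ?_) (fun e he h2 => ?_)
    · rw [abs_mul, abs_mul, abs_of_nonneg (div_nonneg he.1 hD.le)]
      have h1 := hn₁b e he
      have h2 := hκe e he
      have h3 : 0 ≤ e / D := div_nonneg he.1 hD.le
      calc |n₁ e| * (e / D * |κ (e / D)|) ≤ c / lo * (e / D * κ₀) :=
            mul_le_mul h1 (mul_le_mul_of_nonneg_left h2 h3) (by positivity) (div_nonneg hc hlo.le)
        _ = c / lo * (e / D) * κ₀ := by ring
    · rw [hn₁s e he h2, zero_mul]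
  -- the far-line piece: uniform smallness on the split's support, weight `(D − e)/D` of mean `1/2`
  have hp2 : |∫ e in (0 : ℝ)..D, n₂ e * ((D - e) / D * κ (e / D))| ≤ ε₂ / 2 * D := by
    have hbd' : ∀ e : ℝ, e ∈ Ioc (0 : ℝ) D → ‖n₂ e * ((D - e) / D * κ (e / D))‖ ≤ ε₂ * ((D - e) / D) := fun e he => by
      have heI : e ∈ Icc (0 : ℝ) D := ⟨he.1.le, he.2⟩
      rw [Real.norm_eq_abs, show n₂ e * ((D - e) / D * κ (e / D)) = (n₂ e * κ (e / D)) * ((D - e) / D) by ring, abs_mul,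
        abs_of_nonneg (div_nonneg (by linarith [he.2]) hD.le)]
      exact mul_le_mul_of_nonneg_right (hn₂κ e heI) (div_nonneg (by linarith [he.2]) hD.le)
    have h := intervalIntegral.norm_integral_le_of_norm_le (μ := volume) hD.le
      (f := fun e => n₂ e * ((D - e) / D * κ (e / D))) (g := fun e => ε₂ * ((D - e) / D))
      (Filter.Eventually.of_forall hbd')
      ((continuous_const.mul ((continuous_const.sub continuous_id).div_const D)).intervalIntegrable _ _)
    rw [Real.norm_eq_abs] at h
    refine h.trans (le_of_eq ?_)
    have hI : ∫ x in (0 : ℝ)..D, (D - x) = D ^ 2 / 2 := by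
      have h1 : ∫ x in (0 : ℝ)..D, (D - x) = (∫ _ in (0 : ℝ)..D, (D : ℝ)) - ∫ x in (0 : ℝ)..D, x :=
        intervalIntegral.integral_sub (continuous_const.intervalIntegrable _ _) (continuous_id.intervalIntegrable _ _)
      rw [h1, intervalIntegral.integral_const, integral_id, smul_eq_mul]
      ring
    rw [intervalIntegral.integral_const_mul, intervalIntegral.integral_div, hI]
    field_simp
  have htri := abs_add_le (∫ e in (0 : ℝ)..D, n₁ e * (e / D * κ (e / D))) (∫ e in (0 : ℝ)..D, n₂ e * ((D - e) / D * κ (e / D)))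
  calc 1 / D * |(∫ e in (0 : ℝ)..D, n₁ e * (e / D * κ (e / D))) + ∫ e in (0 : ℝ)..D, n₂ e * ((D - e) / D * κ (e / D))|
      ≤ 1 / D * (4 * c * κ₀ * lo / D + ε₂ / 2 * D) := mul_le_mul_of_nonneg_left (htri.trans (add_le_add hp1 hp2)) (by positivity)
    _ = 4 * c * κ₀ * lo / D ^ 2 + ε₂ / 2 := by field_simp

/-! ## §4 p671506's bound with the boundary condition weakened to `n(D)·κ(1) = 0` -/

/-- **`abs_integral_antidiagonal_flatness_le` with the boundary hypothesis `n(D) = 0` replaced by `n(D)·κ(1) = 0`** (so the finer-line split's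
`κ(1) = 0` may discharge it instead of a level cutoff): same conclusion `|∫_0^D Ku| ≤ 8cκ₀·lo/D²`. [folklore] -/
theorem abs_integral_antidiagonal_flatness_le' {n n₁ n₂ κ κ' Ku : ℝ → ℝ} {D lo c κ₀ : ℝ} (hD : 0 < D) (hlo : 0 < lo) (hc : 0 ≤ c) (hκ₀ : 0 ≤ κ₀)
    (hn : ∀ e ∈ Icc 0 D, HasDerivAt n (n₁ e - n₂ e) e) (hn₁c : Continuous n₁) (hn₂c : Continuous n₂)
    (hκ : ∀ t, HasDerivAt κ (κ' t) t) (hκ'c : Continuous κ')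
    (hbd : n D * κ 1 = 0)
    (hn₁b : ∀ e ∈ Icc 0 D, |n₁ e| ≤ c / lo) (hn₁s : ∀ e ∈ Icc 0 D, 2 * lo ≤ e → n₁ e = 0)
    (hn₂b : ∀ e ∈ Icc 0 D, |n₂ e| ≤ c / lo) (hn₂s : ∀ e ∈ Icc 0 D, e ≤ D - 2 * lo → n₂ e = 0)
    (hκb : ∀ t ∈ Icc 0 1, |κ t| ≤ κ₀)
    (hKu : ∀ e ∈ Icc 0 D, Ku e = n₂ e * κ (e / D) / D - n e * (κ' (e / D) * (e / D) + κ (e / D)) / D ^ 2) :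
    |∫ e in (0 : ℝ)..D, Ku e| ≤ 8 * c * κ₀ * lo / D ^ 2 := by
  have hκc : Continuous κ := continuous_iff_continuousAt.2 fun t => (hκ t).continuousAt
  have hD0 : D ≠ 0 := hD.ne'
  rw [intervalIntegral_antidiagonal_eq_cutoff_pieces hD hn hn₁c hn₂c hκ hκ'c hbd hKu, abs_mul,
    abs_of_pos (by positivity : (0 : ℝ) < 1 / D)]
  have hκe : ∀ e ∈ Icc (0 : ℝ) D, |κ (e / D)| ≤ κ₀ := fun e he =>
    hκb (e / D) ⟨div_nonneg he.1 hD.le, (div_le_one hD).2 he.2⟩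
  have hp1 : |∫ e in (0 : ℝ)..D, n₁ e * (e / D * κ (e / D))| ≤ 4 * c * κ₀ * lo / D := by
    refine abs_intervalIntegral_le_of_small_support_left hD hlo hc hκ₀ (fun e he => ?_) (fun e he h2 => ?_)
    · rw [abs_mul, abs_mul, abs_of_nonneg (div_nonneg he.1 hD.le)]
      have h1 := hn₁b e he
      have h2 := hκe e he
      have h3 : 0 ≤ e / D := div_nonneg he.1 hD.le
      calc |n₁ e| * (e / D * |κ (e / D)|) ≤ c / lo * (e / D * κ₀) :=
            mul_le_mul h1 (mul_le_mul_of_nonneg_left h2 h3) (by positivity) (div_nonneg hc hlo.le)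
        _ = c / lo * (e / D) * κ₀ := by ring
    · rw [hn₁s e he h2, zero_mul]
  have hp2 : |∫ e in (0 : ℝ)..D, n₂ e * ((D - e) / D * κ (e / D))| ≤ 4 * c * κ₀ * lo / D := by
    refine abs_intervalIntegral_le_of_small_support_right hD hlo hc hκ₀ (fun e he => ?_) (fun e he h2 => ?_)
    · rw [abs_mul, abs_mul, abs_of_nonneg (div_nonneg (by linarith [he.2]) hD.le)]
      have h1 := hn₂b e he
      have h2 := hκe e he
      have h3 : 0 ≤ (D - e) / D := div_nonneg (by linarith [he.2]) hD.le
      calc |n₂ e| * ((D - e) / D * |κ (e / D)|) ≤ c / lo * ((D - e) / D * κ₀) :=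
            mul_le_mul h1 (mul_le_mul_of_nonneg_left h2 h3) (by positivity) (div_nonneg hc hlo.le)
        _ = c / lo * ((D - e) / D) * κ₀ := by ring
    · rw [hn₂s e he h2, zero_mul]
  have htri := abs_add_le (∫ e in (0 : ℝ)..D, n₁ e * (e / D * κ (e / D))) (∫ e in (0 : ℝ)..D, n₂ e * ((D - e) / D * κ (e / D)))
  calc 1 / D * |(∫ e in (0 : ℝ)..D, n₁ e * (e / D * κ (e / D))) + ∫ e in (0 : ℝ)..D, n₂ e * ((D - e) / D * κ (e / D))|
      ≤ 1 / D * (4 * c * κ₀ * lo / D + 4 * c * κ₀ * lo / D) :=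
        mul_le_mul_of_nonneg_left (htri.trans (add_le_add hp1 hp2)) (by positivity)
    _ = 8 * c * κ₀ * lo / D ^ 2 := by field_simp; ring

end Summit.HubbardSuperconductivity.HubbardSuperconductivity.Theorems.C4a

end
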